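import Literature.Analysis.FluidPDE.HardSphereCollisionRecord
import Literature.Analysis.FluidPDE.HardSphereFreeStretch
import Literature.Analysis.FluidPDE.HardSphereDynamicsProofs
import Literature.Analysis.FluidPDE.HardSphereRegularGeometry
import Literature.MathematicalPhysics.KineticTheory.HardSphereEuler

/-!
# `JParityClosure.RateFloor` (stmt-AtomisticToContinuum-13080), line `Sketch`, stub S3:
# the window pre-emption bound `stub_windowPreemption`

Helper file (`--supports stmt-AtomisticToContinuum-13080`) discharging the stub S3
`stub_windowPreemption` of the lead's skeleton for the crux `JParityClosure.RateFloor`, line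
`Sketch` (stated `let`-free, `W` and `A` universally quantified and pinned by equations, exactly as
registered in the skeleton).  Given the texts of the neighbouring stubs S1 (per-particle free stretch) and S2
(would-be pairs with undeflected endpoints are realised) as hypotheses, on a hard-sphere
trajectory `γ` on `𝕋³` with diameter `0 < ε < 1/2` and a window `(s, t]`, the ordered WOULD-BE
pairs `W` of `γ s` (free flights within `ε` at some time of `(0, t − s]`) number at most
`2·#A + C₂(W)`, where `A` is the set of ordered pairs in contact at some time of `(s, t]` and
`C₂(W)` is the total `W`-degree of the particles of `W`-degree `≥ 2`.

Proof.  (1) Combinatorial core `preempt_card_le` (adapted from the ideator sketch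
`Cruxes/RateFloor/IdeatorThreeSketch.lean`, with the abbreviations `touched`/`star`/`clusterExcess`
unfolded): if every pair of `W` has an endpoint among the endpoints of `A`, then
`#W ≤ 2·#A + C₂(W)`.  (2) Every would-be pair `(i, j)` has an endpoint among the endpoints of
`A`: the pair distance `d(u) = ‖xᵢ(u) − xⱼ(u)‖` along the free flights issued from `γ s` is
continuous, `> ε` on a short interval `(0, δ)` (it starts `≥ ε`, and if `= ε` the pair is
post-collisional on a trajectory, `IsHardSphereTrajectory.isOutgoing_of_mem_contactSet`, hence
separates, `eventually_lt_norm_sepVec_freeFlight_of_isOutgoing`), and `≤ ε` somewhere in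
`(0, t − s]`; by the intermediate value theorem there is a contact time `t₁ ∈ (0, t − s]` of the
free flights.  Either `i` or `j` takes part in a collision during `(s, s + t₁)` — then it is an
endpoint of a pair of `A` — or, by S2 (fed with S1), `i` and `j` collide at `s + t₁ ∈ (s, t]`.
-/

noncomputable section

open scoped Classical
open MeasureTheory Set Filter Topology

namespace Summit.AtomisticToContinuum.HydrodynamicLimit.Theorems

open Literature.Analysis.FluidPDE Literature.MathematicalPhysics.KineticTheory

namespace RateFloorWindowPreemption

/-! ### The pre-emption counting inequality (combinatorial core) -/

section Counting

variable {ι : Type*} [DecidableEq ι]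

-- adapted from Cruxes/RateFloor/IdeatorThreeSketch.lean (`card_touched_le`)
/-- At most two particles per actual collision: the endpoints of a finite set `A` of ordered
pairs number at most `2·#A`. [folklore] -/
theorem card_touched_le (A : Finset (ι × ι)) :
    (A.image Prod.fst ∪ A.image Prod.snd).card ≤ 2 * A.card :=
  calc (A.image Prod.fst ∪ A.image Prod.snd).card
      ≤ (A.image Prod.fst).card + (A.image Prod.snd).card := Finset.card_union_le _ _
    _ ≤ A.card + A.card := Nat.add_le_add Finset.card_image_le Finset.card_image_le
    _ = 2 * A.card := by ring

variable [Fintype ι]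

-- adapted from Cruxes/RateFloor/IdeatorThreeSketch.lean (`preempt_card_le`, with `touched`,
-- `star` and `clusterExcess` unfolded)
/-- **Pre-emption counting inequality.**  If every pair of `W` has an endpoint among the
endpoints of the pairs of `A`, then `#W ≤ 2·#A + C₂(W)`, where `C₂(W)` is the total `W`-degree
of the points of `W`-degree `≥ 2` (every pair of `W` lies in the `W`-star of an endpoint of `A`;
the stars of degree `≤ 1` contribute at most the number `≤ 2·#A` of endpoints, the others at most
`C₂(W)`). [folklore] -/
theorem preempt_card_le (W A : Finset (ι × ι))
    (hW : ∀ p ∈ W, p.1 ∈ A.image Prod.fst ∪ A.image Prod.snd ∨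
      p.2 ∈ A.image Prod.fst ∪ A.image Prod.snd) :
    W.card ≤ 2 * A.card +
      ∑ i ∈ Finset.univ.filter (fun i => 2 ≤ (W.filter fun p => p.1 = i ∨ p.2 = i).card),
        (W.filter fun p => p.1 = i ∨ p.2 = i).card := by
  set T : Finset ι := A.image Prod.fst ∪ A.image Prod.snd with hT
  set star : ι → Finset (ι × ι) := fun i => W.filter fun p => p.1 = i ∨ p.2 = i with hstar
  show W.card ≤ 2 * A.card +
    ∑ i ∈ Finset.univ.filter (fun i => 2 ≤ (star i).card), (star i).card
  -- every pair of `W` lies in the star of an endpoint of `A`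
  have hcover : W ⊆ T.biUnion star := by
    intro p hp
    rcases hW p hp with h | h
    · exact Finset.mem_biUnion.2 ⟨p.1, h, Finset.mem_filter.2 ⟨hp, Or.inl rfl⟩⟩
    · exact Finset.mem_biUnion.2 ⟨p.2, h, Finset.mem_filter.2 ⟨hp, Or.inr rfl⟩⟩
  have h1 : W.card ≤ ∑ i ∈ T, (star i).card :=
    (Finset.card_le_card hcover).trans Finset.card_biUnion_le
  -- split the endpoints by `W`-degree `≤ 1` / `≥ 2`
  have h2 : ∑ i ∈ T, (star i).card
      ≤ ∑ i ∈ T.filter (fun i => (star i).card ≤ 1), (star i).card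
        + ∑ i ∈ T.filter (fun i => ¬ (star i).card ≤ 1), (star i).card := by
    rw [Finset.sum_filter_add_sum_filter_not]
  have h3 : ∑ i ∈ T.filter (fun i => (star i).card ≤ 1), (star i).card ≤ T.card :=
    calc ∑ i ∈ T.filter (fun i => (star i).card ≤ 1), (star i).card
        ≤ ∑ i ∈ T.filter (fun i => (star i).card ≤ 1), 1 :=
          Finset.sum_le_sum fun i hi => (Finset.mem_filter.1 hi).2
      _ = (T.filter (fun i => (star i).card ≤ 1)).card := by simp
      _ ≤ T.card := Finset.card_filter_le _ _
  have h4 : ∑ i ∈ T.filter (fun i => ¬ (star i).card ≤ 1), (star i).card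
      ≤ ∑ i ∈ Finset.univ.filter (fun i => 2 ≤ (star i).card), (star i).card := by
    apply Finset.sum_le_sum_of_subset_of_nonneg
    · intro i hi
      rw [Finset.mem_filter] at hi ⊢
      exact ⟨Finset.mem_univ i, by omega⟩
    · intro i _ _
      exact Nat.zero_le _
  have h5 : T.card ≤ 2 * A.card := card_touched_le A
  omega

end Counting

/-! ### Endpoints of actual collisions -/

section Touched

variable {d X : Type*} [Fintype d] {G : Geometry d X} {ε : ℝ} {N : ℕ}

/-- A particle that takes part in a collision at some time of the window `(s, t]` is an
endpoint of an ordered pair in contact at some time of `(s, t]`. [folklore] -/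
theorem mem_touched_of_participates {γ : ℝ → Config N d X} {s t u : ℝ} (hu : u ∈ Set.Ioc s t)
    {i : Fin N} (hi : Participates G ε (γ u) i) :
    i ∈ (Finset.univ.filter fun p : Fin N × Fin N =>
        ∃ u ∈ Set.Ioc s t, p ∈ contactPairs G ε (γ u)).image Prod.fst ∪
      (Finset.univ.filter fun p : Fin N × Fin N =>
        ∃ u ∈ Set.Ioc s t, p ∈ contactPairs G ε (γ u)).image Prod.snd := by
  obtain ⟨l, hil | hli⟩ := hi
  · exact Finset.mem_union_left _ (Finset.mem_image.2
      ⟨(i, l), Finset.mem_filter.2 ⟨Finset.mem_univ _, u, hu, hil⟩, rfl⟩)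
  · exact Finset.mem_union_right _ (Finset.mem_image.2
      ⟨(l, i), Finset.mem_filter.2 ⟨Finset.mem_univ _, u, hu, hli⟩, rfl⟩)

end Touched

/-! ### First contact of two free flights -/

/-- **A positive contact time by the intermediate value theorem.**  If a continuous real function
`d` exceeds `ε` on a short interval `(0, δ)` and is `≤ ε` somewhere in `(0, T]`, then it takes the
value `ε` at some point of `(0, T]`. [folklore] -/
theorem exists_pos_contact {d : ℝ → ℝ} (hd : Continuous d) {T ε δ : ℝ} (hδ : 0 < δ)
    (hsep : ∀ u ∈ Set.Ioo 0 δ, ε < d u) (hex : ∃ u ∈ Set.Ioc 0 T, d u ≤ ε) :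
    ∃ t₁ ∈ Set.Ioc 0 T, d t₁ = ε := by
  obtain ⟨u₀, hu₀, hle⟩ := hex
  have hδu : δ ≤ u₀ := not_lt.1 fun hlt => (hsep u₀ ⟨hu₀.1, hlt⟩).not_ge hle
  have hlt : ε < d (δ / 2) := hsep (δ / 2) ⟨by linarith, by linarith⟩
  obtain ⟨c, hc, hcε⟩ :=
    intermediate_value_Icc' (show δ / 2 ≤ u₀ by linarith) hd.continuousOn ⟨hle, hlt.le⟩
  exact ⟨c, ⟨by linarith [hc.1], hc.2.trans hu₀.2⟩, hcε⟩

/-- **Free flights issued from a trajectory separate at first.**  On a hard-sphere trajectory on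
the torus (`ε < 1/2`), the free flights of two distinct particles issued from `γ s` are at
distance `> ε` during a short time interval `(0, δ)`: at `s` they are at distance `≥ ε`, and if
`= ε` the pair is post-collisional (`IsHardSphereTrajectory.isOutgoing_of_mem_contactSet`), hence
separates (`eventually_lt_norm_sepVec_freeFlight_of_isOutgoing`). [folklore] -/
theorem exists_sep_window {N : ℕ} {ε : ℝ} {γ : ℝ → Config N (Fin 3) T3}
    (h : IsHardSphereTrajectory (Torus.geometry (Fin 3)) ε N γ) (hε2 : ε < 2⁻¹) (s : ℝ)
    {i j : Fin N} (hij : i ≠ j) :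
    ∃ δ > 0, ∀ u ∈ Set.Ioo 0 δ, ε < ‖(Torus.geometry (Fin 3)).sepVec
      (freeFlight (Torus.geometry (Fin 3)) u (γ s) i).1
      (freeFlight (Torus.geometry (Fin 3)) u (γ s) j).1‖ := by
  have hG := Torus.isHardSphereRegular_geometry (d := Fin 3) hε2
  have hev : ∀ᶠ u in 𝓝[>] (0 : ℝ), ε < ‖(Torus.geometry (Fin 3)).sepVec
      (freeFlight (Torus.geometry (Fin 3)) u (γ s) i).1
      (freeFlight (Torus.geometry (Fin 3)) u (γ s) j).1‖ := by
    rcases (h.mem s i j hij).eq_or_lt with hc | hlt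
    · exact hG.eventually_lt_norm_sepVec_freeFlight_of_isOutgoing hc.symm
        (h.isOutgoing_of_mem_contactSet hij ⟨h.mem s, hc.symm⟩)
    · exact (hG.eventually_lt_norm_sepVec_freeFlight_of_lt hlt).filter_mono nhdsWithin_le_nhds
  obtain ⟨δ, hδ, hsub⟩ := mem_nhdsGT_iff_exists_Ioo_subset.1 hev
  exact ⟨δ, hδ, fun u hu => hsub hu⟩

/-! ### The stub -/

/-- **S3 · window pre-emption bound** (stub `stub_windowPreemption` of crux
stmt-AtomisticToContinuum-13080, line `Sketch`, in `let`-free form: the would-be set `W` and the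
actual-contact set `A` enter as universally quantified finsets pinned by equations, as registered).
Given S1 (per-particle free stretch) and
S2 (would-be pairs with undeflected endpoints are realised): on a hard-sphere trajectory on `𝕋³`
with `0 < ε < 1/2` and a window `(s, t]`, the ordered would-be pairs `W` of `γ s` for the window
length `t − s` number at most `2·#A + C₂(W)`, `A` the ordered pairs in contact at some time of
`(s, t]`.  Every would-be pair `(i, j)` has a positive contact time `t₁ ∈ (0, t − s]` of its free
flights (`exists_sep_window`, `exists_pos_contact`); either an endpoint takes part in a collision
during `(s, s + t₁)`, or by S2 the pair collides at `s + t₁`; in both cases an endpoint is an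
endpoint of `A` (`mem_touched_of_participates`), and `preempt_card_le` counts. [folklore] -/
theorem stub_windowPreemption :
    (∀ (N : ℕ) (ε : ℝ) (γ : ℝ → Config N (Fin 3) T3),
      IsHardSphereTrajectory (Torus.geometry (Fin 3)) ε N γ →
      ∀ (s t : ℝ) (k : Fin N), s ≤ t →
        (∀ u ∈ Set.Ioc s t, u ∉ collisionTimesOf (Torus.geometry (Fin 3)) ε γ k) →
        γ t k = freeFlight (Torus.geometry (Fin 3)) (t - s) (γ s) k) →
    ((∀ (N : ℕ) (ε : ℝ) (γ : ℝ → Config N (Fin 3) T3),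
      IsHardSphereTrajectory (Torus.geometry (Fin 3)) ε N γ →
      ∀ (s t : ℝ) (k : Fin N), s ≤ t →
        (∀ u ∈ Set.Ioc s t, u ∉ collisionTimesOf (Torus.geometry (Fin 3)) ε γ k) →
        γ t k = freeFlight (Torus.geometry (Fin 3)) (t - s) (γ s) k) →
    ∀ (N : ℕ) (ε : ℝ) (γ : ℝ → Config N (Fin 3) T3),
    IsHardSphereTrajectory (Torus.geometry (Fin 3)) ε N γ →
    ∀ (s t : ℝ) (i j : Fin N), s < t → i ≠ j →
      (∀ u ∈ Set.Ioo s t, u ∉ collisionTimesOf (Torus.geometry (Fin 3)) ε γ i) →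
      (∀ u ∈ Set.Ioo s t, u ∉ collisionTimesOf (Torus.geometry (Fin 3)) ε γ j) →
      ‖(Torus.geometry (Fin 3)).sepVec (freeFlight (Torus.geometry (Fin 3)) (t - s) (γ s) i).1
          (freeFlight (Torus.geometry (Fin 3)) (t - s) (γ s) j).1‖ = ε →
      Collide (Torus.geometry (Fin 3)) ε (γ t) i j) →
    ∀ (N : ℕ) (ε : ℝ) (γ : ℝ → Config N (Fin 3) T3),
    IsHardSphereTrajectory (Torus.geometry (Fin 3)) ε N γ → 0 < ε → ε < 2⁻¹ →
    ∀ (s t : ℝ), s < t →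
      ∀ (W A : Finset (Fin N × Fin N)),
      (W = Finset.univ.filter fun p => p.1 ≠ p.2 ∧
        ∃ u ∈ Set.Ioc 0 (t - s), ‖(Torus.geometry (Fin 3)).sepVec
          (freeFlight (Torus.geometry (Fin 3)) u (γ s) p.1).1 (freeFlight (Torus.geometry (Fin 3)) u (γ s) p.2).1‖ ≤ ε) →
      (A = Finset.univ.filter fun p =>
        ∃ u ∈ Set.Ioc s t, p ∈ contactPairs (Torus.geometry (Fin 3)) ε (γ u)) →
      W.card ≤ 2 * A.card +
        ∑ i ∈ Finset.univ.filter (fun i => 2 ≤ (W.filter fun p => p.1 = i ∨ p.2 = i).card),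
          (W.filter fun p => p.1 = i ∨ p.2 = i).card := by
  intro hS1 hS2 N ε γ h _hε hε2 s t _hst W A hW hA
  subst hW hA
  have hG : (Torus.geometry (Fin 3)).IsHardSphereRegular ε := Torus.isHardSphereRegular_geometry hε2
  refine preempt_card_le _ _ fun p hp => ?_
  obtain ⟨-, hij, hex⟩ := Finset.mem_filter.1 hp
  -- a short initial stretch of strict separation, then a positive contact time `t₁`
  obtain ⟨δ, hδ, hsep⟩ := exists_sep_window h hε2 s hij
  have hcont : Continuous fun u : ℝ => ‖(Torus.geometry (Fin 3)).sepVec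
      (freeFlight (Torus.geometry (Fin 3)) u (γ s) p.1).1
      (freeFlight (Torus.geometry (Fin 3)) u (γ s) p.2).1‖ := by
    simpa only [Function.comp_def] using
      (hG.continuous_norm_sepVec_config p.1 p.2).comp (hG.continuous_freeFlight (γ s))
  obtain ⟨t₁, ht₁, hcontact⟩ := exists_pos_contact hcont hδ hsep hex
  -- either an endpoint is deflected during `(s, s + t₁)` ...
  by_cases hpi : ∃ u ∈ Set.Ioo s (s + t₁), Participates (Torus.geometry (Fin 3)) ε (γ u) p.1
  · obtain ⟨u, hu, hpart⟩ := hpi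
    exact Or.inl (mem_touched_of_participates ⟨hu.1, by linarith [hu.2, ht₁.2]⟩ hpart)
  by_cases hpj : ∃ u ∈ Set.Ioo s (s + t₁), Participates (Torus.geometry (Fin 3)) ε (γ u) p.2
  · obtain ⟨u, hu, hpart⟩ := hpj
    exact Or.inr (mem_touched_of_participates ⟨hu.1, by linarith [hu.2, ht₁.2]⟩ hpart)
  -- ... or, by S2, the would-be pair is realised at `s + t₁ ∈ (s, t]`
  have hcol : Collide (Torus.geometry (Fin 3)) ε (γ (s + t₁)) p.1 p.2 :=
    hS2 hS1 N ε γ h s (s + t₁) p.1 p.2 (by linarith [ht₁.1]) hij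
      (fun u hu hmem => hpi ⟨u, hu, mem_collisionTimesOf.1 hmem⟩)
      (fun u hu hmem => hpj ⟨u, hu, mem_collisionTimesOf.1 hmem⟩)
      (by rw [add_sub_cancel_left]; exact hcontact)
  exact Or.inl (mem_touched_of_participates ⟨by linarith [ht₁.1], by linarith [ht₁.2]⟩ ⟨p.2, hcol⟩)

end RateFloorWindowPreemption

end Summit.AtomisticToContinuum.HydrodynamicLimit.Theorems

end
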